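import Literature.NumberTheory.Rogawski1990.ArchCompactWallTransversalTrace    -- ★ p843385 (A-p14 (g28)): the trace form of `N²Φ` at a compact wall, `archLocal` tokens
import Literature.NumberTheory.Automorphic.ArchLocalDiagonalFrameU21           -- ★ p843380 (A-p18 (g25)): `archLocalEquivU21`-bridges `g ↦ T⁻¹gT`, transport of integrals and invariance
import Literature.Geometry.ComplexHyperbolic.UnitBallKCentralTransversalDatum  -- ★ p843606 (this seat, (A4-χ-DATUM)): `Λ_χ`, `contDiff_two_transversalDatum`, `exists_sq_support_bound_transversalDatum`
import Literature.Geometry.ComplexHyperbolic.UnitBallKCentralWallCurveJets    -- ★ p05: generic ENGINE-T jets `derivWithin_integral_family_zero`, `iteratedDerivWithin_two_integral_family_zero`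
import HarnessLib

/-!
# The trace form of `N²Φ` at the compact wall, read on the ball group `U21`, and the `χ`-germ of ROAD A
# (★ `ArchCompactWallTransversalTrace` transported along `archLocal ℂ 3 diag(1,1,−1) w ≃ₜ* U21` with frame `T = 1`; Rogawski 1990 §8.4, Varadarajan §6.4)

Topic `Geometry/ComplexHyperbolic`; namespace `Literature.Geometry.ComplexHyperbolic.BallModel`.  THEOREMS ONLY (no `def`, no instance, no notation, no axiom, no named fact,
no `sorry`).  Cell `pub/hodgecm-mathlib`, ENGINE T1 (crux H413 = `stmt-HodgeConjecture-24833`); floor-1½ preparation, count-neutral, under row (S-d) ∕ «SdArch» ED. 3 node N1 =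
the (L_{U(2,1)}) letter (`stub_ArchCentralLimitU21` ∕ closer `stub_L21`): brick **ROAD A (A4-χ-TRACE)** — the last link of the ROAD A owner F0P3a-p05 (g13)'s SHAPE REQUEST
10:18:00Z item 4 («`‖v_t−u_t‖⁴ • N²Φ_Θ(k_t) = c • ∫ W, Λ_χ (t, W, √(2 sin(3t∕2) + nsq W))`»).  Over ★ (A2″) `ArchCompactWallTransversalTrace` (A-p14 (g28): the trace form of `N²Φ` for every
`archLocal L N (diag α) w`), ★ (A4-iv) `ArchLocalDiagonalFrameU21` (A-p18 (g25): bridges `g ↦ T⁻¹gT`, transport of orbital integrals), ★ (A4-χ-ID) `UnitBallKCentralTransversalSheet` and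
★ (A4-χ-DATUM) `UnitBallKCentralTransversalDatum` (this seat).  Author A-p14 (g29), 2026-09-01.

THE MATHEMATICS.  ★ p843385 proves, for `G_w = archLocal L N (diag α) w` with `σ_w(α_i) = σ_w(α_j)`, `ν` right-invariant and finite on compacts, `Θ ∈ C^∞` with `k ↦ Θ(↑↑k)` compactly supported:
`∂²_y|₀ ∫_{G_w} Θ(↑↑(g t_y g⁻¹)) dν = ∫_{G_w} ( ⅓Σ_a D²Θ(h_g)[ζ_i•Ad(g)y_a]² − DΘ(h_g)[ζ_i•Ad(g)(E_ii+E_jj)] ) dν`.  The ball group `U21 = U(diag(1,1,−1))` is such a `G_w`: take the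
field `L := ℂ`, `α := (1,1,−1)`, and ANY complex place `w` of `ℂ` (§1: `mk id` is complex; `σ_w(±1) = ±1`, so `σ_w(diag α) = J` and the frame `T = 1` has `formCongr conj 1 (σ_w diag α) = J`); the
bridge `e := archLocalEquivU21 ℂ (diag α) w 1 _ : G₀ ≃ₜ* U21` is the identity on matrices (§1).  For a measure `μ` on `U21` put `ν := μ.map e.symm` (§2: right-invariance and finiteness on compacts
transport; `ν.map e = μ`); ★ p843385 on `G₀` with `(i,j) = (0,1)`, `ζ = (u_t,u_t,v_t)` (block separation = `u_t ≠ v_t`) transports term by term (`integral_map_equiv`; ★ A-p18's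
`integral_comp_conj_eq_integral_map_of_conj_frame` for the left side) to
* §3 **`iteratedDeriv_two_integral_kCentral_wallLine_eq_integral_transversalBracket`**: for `μ` right-invariant, finite on compacts, `Θ ∈ C^∞`, `u ↦ Θ(mat u)` compactly supported, `u_t ≠ v_t`:
  `∂²_y|₀ ∫_{U21} Θ(mat u · diag(u_t e^{iy}, u_t e^{−iy}, v_t) · mat u⁻¹) dμ = ∫_{U21} ( ⅓Σ_a D²Θ(mat(u k_t u⁻¹))[u_t•Ad(u)y_a]² − DΘ(mat(u k_t u⁻¹))[u_t•Ad(u)(E₀₀+E₁₁)] ) dμ`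
  — the right side is EXACTLY the bracket of ★ `exists_norm_sub_pow_four_smul_integral_transversalBracket_eq`; hence
* §4 the one-sided jets `𝓘_χ′(0⁺)`, `𝓘_χ″(0⁺)` of `𝓘_χ(t) = ∫ Λ_χ(t, W, √(2 sin(3t∕2)+|W|²)) d⁴W` in `DΛ_χ`-form (★ p05's generic ENGINE-T jets at the datum `Λ_χ`).
The assembly `χ(t) = ‖v_t − u_t‖⁴ • N²Φ_Θ(k_t) = c • 𝓘_χ(t)` (§3 + ★ `exists_norm_sub_pow_four_smul_integral_transversalBracket_eq`) is the sequel `UnitBallKCentralTransversalGerm` (one `rw`);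
the unimodularity of `U(2,1)` (Haar ⇒ right-invariant) is not proved here: the road's letter quantifies right-invariant `ν` while the ball push-forward uses a left Haar measure.
HONEST LABEL: HC_CM is proved only modulo the printed citations until rung 0 closes; this file is transport bookkeeping over ★ files and pays nothing by itself.

## References
* [Rogawski1990] J. D. Rogawski, *Automorphic Representations of Unitary Groups in Three Variables*, Ann. of Math. Stud. 123 (1990), §8.4 pp. 126–127 (the second transversal derivative of the
  singular orbital integrals at the compact wall of `U(2,1)`).
* [Varadarajan1989] V. S. Varadarajan, *An Introduction to Harmonic Analysis on Semisimple Lie Groups* (1989), §6.4 (second-order germs of `F_f` at singular points).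
* [PlatonovRapinchuk1994] V. Platonov, A. Rapinchuk, *Algebraic Groups and Number Theory* (1994), §2.3 (unitary groups of hermitian forms under change of frame; the split∕signature models).
-/

set_option autoImplicit false

noncomputable section

open MeasureTheory MeasureTheory.Measure Set Filter Topology Matrix Complex NumberField NumberField.InfinitePlace
open Literature.NumberTheory.Automorphic Literature.NumberTheory.Automorphic.UnitaryGroup
open scoped Matrix.Norms.Operator ComplexConjugate ContDiff

namespace Literature.Geometry.ComplexHyperbolic.BallModel

/-! ### §1 The model archimedean place of `ℂ` and the identity bridge `U(diag(1,1,−1))(ℂ) ≃ₜ* U21` -/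

/-- The identity embedding of `ℂ` defines a COMPLEX infinite place (`conj ≠ id`). [cite: PlatonovRapinchuk1994, §2.3] -/
theorem isComplex_mk_ringHom_id : (InfinitePlace.mk (RingHom.id ℂ)).IsComplex := by
  rw [isComplex_mk_iff, ComplexEmbedding.isReal_iff]
  intro h
  have h1 := congrArg (fun φ : ℂ →+* ℂ => φ I) h
  simp only [ComplexEmbedding.conjugate_coe_eq, RingHom.id_apply, Complex.conj_I] at h1
  exact I_ne_zero (by linear_combination (-1 : ℂ) * h1 / 2)

/-- At ANY complex place `w` of the field `ℂ`, `σ_w(diag(1,1,−1)) = J = diag(1,1,−1)` (a ring morphism fixes `±1`). [cite: PlatonovRapinchuk1994, §2.3] -/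
theorem diagonal_map_embedding_eq_J (w : {w : InfinitePlace ℂ // IsComplex w}) :
    (Matrix.diagonal (![(1 : ℂ), 1, -1] : Fin 3 → ℂ)).map w.1.embedding = BallModel.J := by
  rw [Matrix.diagonal_map (map_zero _), BallModel.J]
  congr 1
  funext i
  fin_cases i <;> simp

/-- The identity frame: `formCongr conj 1 (σ_w diag(1,1,−1)) = J` (★ `formCongr_one_eq`). [cite: PlatonovRapinchuk1994, §2.3] -/
theorem formCongr_one_diagonal_map_eq_J (w : {w : InfinitePlace ℂ // IsComplex w}) :
    formCongr (starRingEnd ℂ) (1 : GL (Fin 3) ℂ) ((Matrix.diagonal (![(1 : ℂ), 1, -1] : Fin 3 → ℂ)).map w.1.embedding) = BallModel.J := by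
  show ((((1 : GL (Fin 3) ℂ) : Matrix (Fin 3) (Fin 3) ℂ).map (starRingEnd ℂ))ᵀ * _ * ((1 : GL (Fin 3) ℂ) : Matrix (Fin 3) (Fin 3) ℂ)) = _
  rw [Units.val_one, Matrix.map_one _ (map_zero _) (map_one _), Matrix.transpose_one, Matrix.one_mul, Matrix.mul_one, diagonal_map_embedding_eq_J]

/-- The identity bridge `e₁ := archLocalEquivU21 ℂ diag(1,1,−1) w 1 _` is the identity on underlying invertible matrices. [cite: PlatonovRapinchuk1994, §2.3] -/
theorem coe_archLocalEquivU21_one (w : {w : InfinitePlace ℂ // IsComplex w}) (g : archLocal ℂ 3 (Matrix.diagonal (![(1 : ℂ), 1, -1] : Fin 3 → ℂ)) w) :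
    ((archLocalEquivU21 ℂ (Matrix.diagonal (![(1 : ℂ), 1, -1] : Fin 3 → ℂ)) w 1 (formCongr_one_diagonal_map_eq_J w) g : U21) : GL (Fin 3) ℂ) =
      (g : GL (Fin 3) ℂ) := by
  rw [coe_archLocalEquivU21_apply, inv_one, one_mul, mul_one]

/-- … in the `T⁻¹ g T` shape of ★ `ArchLocalDiagonalFrameU21` (with `T = 1`). [cite: PlatonovRapinchuk1994, §2.3] -/
theorem coe_archLocalEquivU21_one' (w : {w : InfinitePlace ℂ // IsComplex w}) (g : archLocal ℂ 3 (Matrix.diagonal (![(1 : ℂ), 1, -1] : Fin 3 → ℂ)) w) :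
    ((archLocalEquivU21 ℂ (Matrix.diagonal (![(1 : ℂ), 1, -1] : Fin 3 → ℂ)) w 1 (formCongr_one_diagonal_map_eq_J w) g : U21) : GL (Fin 3) ℂ) =
      (1 : GL (Fin 3) ℂ)⁻¹ * (g : GL (Fin 3) ℂ) * 1 :=
  coe_archLocalEquivU21_apply _ _ _ _ _ g

/-- … and so is its inverse. [cite: PlatonovRapinchuk1994, §2.3] -/
theorem coe_archLocalEquivU21_one_symm (w : {w : InfinitePlace ℂ // IsComplex w}) (u : U21) :
    (((archLocalEquivU21 ℂ (Matrix.diagonal (![(1 : ℂ), 1, -1] : Fin 3 → ℂ)) w 1 (formCongr_one_diagonal_map_eq_J w)).symm u : archLocal ℂ 3 (Matrix.diagonal (![(1 : ℂ), 1, -1] : Fin 3 → ℂ)) w) : GL (Fin 3) ℂ) =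
      (u : GL (Fin 3) ℂ) := by
  rw [coe_symm_eq_of_conj_frame ℂ _ w 1 _ (coe_archLocalEquivU21_one' w) u, inv_one, one_mul, mul_one]

/-! ### §2 Transport of measures along a topological-group isomorphism (the direction `U21 → archLocal`) -/

/-- The image of a right-invariant measure under an isomorphism of topological groups is right-invariant. [cite: PlatonovRapinchuk1994, §2.3] -/
theorem isMulRightInvariant_map_continuousMulEquiv {A B : Type*} [Group A] [Group B] [TopologicalSpace A] [TopologicalSpace B]
    [IsTopologicalGroup A] [IsTopologicalGroup B] [MeasurableSpace A] [MeasurableSpace B] [BorelSpace A] [BorelSpace B]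
    (e : A ≃ₜ* B) (ν : Measure A) [ν.IsMulRightInvariant] : (ν.map e).IsMulRightInvariant := by
  refine ⟨fun h => ?_⟩
  have he : Measurable (e : A → B) := (e.continuous : Continuous (e : A → B)).measurable
  obtain ⟨g, rfl⟩ := e.surjective h
  rw [Measure.map_map (measurable_mul_const _) he]
  conv_rhs => rw [← map_mul_right_eq_self ν g]
  rw [Measure.map_map he (measurable_mul_const _)]
  congr 1
  funext x
  simp only [Function.comp_apply, map_mul]

/-- `(ν.map e.symm).map e = ν` for an isomorphism of topological groups `e`. [cite: PlatonovRapinchuk1994, §2.3] -/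
theorem map_symm_map_continuousMulEquiv {A B : Type*} [Group A] [Group B] [TopologicalSpace A] [TopologicalSpace B]
    [MeasurableSpace A] [MeasurableSpace B] [BorelSpace A] [BorelSpace B] (e : A ≃ₜ* B) (μ : Measure B) :
    (μ.map e.symm).map e = μ := by
  have he : Measurable (e : A → B) := (e.continuous : Continuous (e : A → B)).measurable
  have hes : Measurable (e.symm : B → A) := (e.symm.continuous : Continuous (e.symm : B → A)).measurable
  rw [Measure.map_map he hes]
  have : ((e : A → B) ∘ (e.symm : B → A)) = id := funext fun x => e.apply_symm_apply x
  rw [this, Measure.map_id]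

/-! ### §3 THE TRACE FORM OF `N²Φ` ON THE BALL GROUP `U21` -/

section Trace

variable {G : Type*} [NormedAddCommGroup G] [NormedSpace ℝ G] [CompleteSpace G]

/-- **THE TRACE FORM OF `N²Φ` AT THE COMPACT WALL OF `U(2,1)`, BALL-MODEL TOKENS** — ★ `iteratedDeriv_two_integral_wallLine_eq_integral_third_trace_sub_gradient` (A-p14 (g28), for every
`archLocal L N (diag α) w`) read on `U21` through the identity bridge `archLocal ℂ 3 diag(1,1,−1) w ≃ₜ* U21` (`T = 1`): for a right-invariant measure `μ` finite on compacts, `Θ ∈ C^∞` with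
`u ↦ Θ(mat u)` compactly supported, `ζ ∈ S¹` and `t` with `u_t = ζe^{it} ≠ v_t = ζe^{−2it}` (block separation; true on `(0, 2π∕3)`), writing `k_t = diag(u_t,u_t,v_t)` and the normal line
`k_{t,y} = diag(u_t e^{iy}, u_t e^{−iy}, v_t)`:
`∂²_y|₀ ∫_{U21} Θ(mat u · k_{t,y} · mat u⁻¹) dμ = ∫_{U21} ( ⅓Σ_a D²Θ(mat(u k_t u⁻¹))[u_t•Ad(u)y_a]² − DΘ(mat(u k_t u⁻¹))[u_t•Ad(u)(E₀₀+E₁₁)] ) dμ`.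
[cite: Rogawski1990, §8.4 p. 126] [cite: Varadarajan1989, §6.4] [cite: PlatonovRapinchuk1994, §2.3] -/
theorem iteratedDeriv_two_integral_kCentral_wallLine_eq_integral_transversalBracket (μ : Measure U21) [IsFiniteMeasureOnCompacts μ] [μ.IsMulRightInvariant]
    (Θ : Matrix (Fin 3) (Fin 3) ℂ → G) (hΘ : ContDiff ℝ ∞ Θ) (hΘc : HasCompactSupport fun u : U21 => Θ (mat u))
    (ζ : Circle) (t : ℝ) (huv : (ζ * Circle.exp t : Circle) ≠ ζ * Circle.exp (-2 * t)) :
    iteratedDeriv 2 (fun y : ℝ => ∫ u : U21, Θ (mat u * Matrix.diagonal (fun k : Fin 3 => (((![ζ * Circle.exp t, ζ * Circle.exp t, ζ * Circle.exp (-2 * t)] : Fin 3 → Circle) k *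
          Circle.exp (y * ((if k = (0 : Fin 3) then (1 : ℝ) else 0) - (if k = (1 : Fin 3) then (1 : ℝ) else 0))) : Circle) : ℂ)) * mat u⁻¹) ∂μ) 0 =
      ∫ u : U21, ((1 / 3 : ℝ) • (iteratedFDeriv ℝ 2 Θ (mat (u * mkU21 (Matrix.diagonal ![((ζ * Circle.exp t : Circle) : ℂ), ((ζ * Circle.exp t : Circle) : ℂ), ((ζ * Circle.exp (-2 * t) : Circle) : ℂ)]) (diagonal_uuv_preserves (ζ * Circle.exp t) (ζ * Circle.exp (-2 * t))) * u⁻¹)) ![((ζ * Circle.exp t : Circle) : ℂ) • (mat u * (I • (Matrix.single 0 0 (1 : ℂ) - Matrix.single 1 1 1)) * mat u⁻¹), ((ζ * Circle.exp t : Circle) : ℂ) • (mat u * (I • (Matrix.single 0 0 (1 : ℂ) - Matrix.single 1 1 1)) * mat u⁻¹)] +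
            iteratedFDeriv ℝ 2 Θ (mat (u * mkU21 (Matrix.diagonal ![((ζ * Circle.exp t : Circle) : ℂ), ((ζ * Circle.exp t : Circle) : ℂ), ((ζ * Circle.exp (-2 * t) : Circle) : ℂ)]) (diagonal_uuv_preserves (ζ * Circle.exp t) (ζ * Circle.exp (-2 * t))) * u⁻¹)) ![((ζ * Circle.exp t : Circle) : ℂ) • (mat u * (Matrix.single 0 1 (1 : ℂ) - Matrix.single 1 0 1) * mat u⁻¹), ((ζ * Circle.exp t : Circle) : ℂ) • (mat u * (Matrix.single 0 1 (1 : ℂ) - Matrix.single 1 0 1) * mat u⁻¹)] +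
            iteratedFDeriv ℝ 2 Θ (mat (u * mkU21 (Matrix.diagonal ![((ζ * Circle.exp t : Circle) : ℂ), ((ζ * Circle.exp t : Circle) : ℂ), ((ζ * Circle.exp (-2 * t) : Circle) : ℂ)]) (diagonal_uuv_preserves (ζ * Circle.exp t) (ζ * Circle.exp (-2 * t))) * u⁻¹)) ![((ζ * Circle.exp t : Circle) : ℂ) • (mat u * (I • (Matrix.single 0 1 (1 : ℂ) + Matrix.single 1 0 1)) * mat u⁻¹), ((ζ * Circle.exp t : Circle) : ℂ) • (mat u * (I • (Matrix.single 0 1 (1 : ℂ) + Matrix.single 1 0 1)) * mat u⁻¹)]) -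
          fderiv ℝ Θ (mat (u * mkU21 (Matrix.diagonal ![((ζ * Circle.exp t : Circle) : ℂ), ((ζ * Circle.exp t : Circle) : ℂ), ((ζ * Circle.exp (-2 * t) : Circle) : ℂ)]) (diagonal_uuv_preserves (ζ * Circle.exp t) (ζ * Circle.exp (-2 * t))) * u⁻¹)) (((ζ * Circle.exp t : Circle) : ℂ) • (mat u * (Matrix.single 0 0 (1 : ℂ) + Matrix.single 1 1 1) * mat u⁻¹))) ∂μ := by
  -- the model place, the identity bridge, the transported measure
  let w : {w : InfinitePlace ℂ // IsComplex w} := ⟨InfinitePlace.mk (RingHom.id ℂ), isComplex_mk_ringHom_id⟩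
  let e := archLocalEquivU21 ℂ (Matrix.diagonal (![(1 : ℂ), 1, -1] : Fin 3 → ℂ)) w 1 (formCongr_one_diagonal_map_eq_J w)
  have he := coe_archLocalEquivU21_one' w
  have hes := coe_archLocalEquivU21_one_symm w
  borelize (↥(archLocal ℂ 3 (Matrix.diagonal (![(1 : ℂ), 1, -1] : Fin 3 → ℂ)) w))
  set ν : Measure (archLocal ℂ 3 (Matrix.diagonal (![(1 : ℂ), 1, -1] : Fin 3 → ℂ)) w) := μ.map e.symm with hν
  haveI : IsFiniteMeasureOnCompacts ν := IsFiniteMeasureOnCompacts.map μ e.symm.toHomeomorph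
  haveI : ν.IsMulRightInvariant := isMulRightInvariant_map_continuousMulEquiv e.symm μ
  have hνe : ν.map e = μ := map_symm_map_continuousMulEquiv e μ
  -- hypotheses of ★
  have hemb : ∀ i, w.1.embedding ((![(1 : ℂ), 1, -1] : Fin 3 → ℂ) i) = (![(1 : ℂ), 1, -1] : Fin 3 → ℂ) i := by intro i; fin_cases i <;> simp
  have hα : ∀ i, (![(1 : ℂ), 1, -1] : Fin 3 → ℂ) i ≠ 0 := by intro i; fin_cases i <;> simp
  have hreal : ∀ i, (w.1.embedding ((![(1 : ℂ), 1, -1] : Fin 3 → ℂ) i)).im = 0 := by intro i; rw [hemb]; fin_cases i <;> simp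
  have hsign : ∀ i j : Fin 3, i ≠ j → (![(0 : ℕ), 0, 1] : Fin 3 → ℕ) i = (![(0 : ℕ), 0, 1] : Fin 3 → ℕ) j →
      0 < (w.1.embedding ((![(1 : ℂ), 1, -1] : Fin 3 → ℂ) i)).re * (w.1.embedding ((![(1 : ℂ), 1, -1] : Fin 3 → ℂ) j)).re := by
    intro i j hij hb
    rw [hemb, hemb]
    fin_cases i <;> fin_cases j <;> simp_all
  have hfc : HasCompactSupport fun k : archLocal ℂ 3 (Matrix.diagonal (![(1 : ℂ), 1, -1] : Fin 3 → ℂ)) w => Θ ((k : GL (Fin 3) ℂ) : Matrix (Fin 3) (Fin 3) ℂ) := by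
    have h := hΘc.comp_homeomorph e.toHomeomorph
    have hfun : ((fun u : U21 => Θ (mat u)) ∘ e.toHomeomorph) = fun k : archLocal ℂ 3 (Matrix.diagonal (![(1 : ℂ), 1, -1] : Fin 3 → ℂ)) w => Θ ((k : GL (Fin 3) ℂ) : Matrix (Fin 3) (Fin 3) ℂ) := by
      funext k
      show Θ (mat (e k)) = _
      rw [show mat (e k) = (((e k : U21) : GL (Fin 3) ℂ) : Matrix (Fin 3) (Fin 3) ℂ) from rfl, he k, inv_one, one_mul, mul_one]
    rwa [hfun] at h
  have hζ : ∀ k l : Fin 3, (![(0 : ℕ), 0, 1] : Fin 3 → ℕ) k ≠ (![(0 : ℕ), 0, 1] : Fin 3 → ℕ) l → (![ζ * Circle.exp t, ζ * Circle.exp t, ζ * Circle.exp (-2 * t)] : Fin 3 → Circle) k ≠ (![ζ * Circle.exp t, ζ * Circle.exp t, ζ * Circle.exp (-2 * t)] : Fin 3 → Circle) l := by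
    intro k l hkl
    fin_cases k <;> fin_cases l <;> first | exact absurd rfl hkl | exact huv | exact huv.symm
  have hb : ∀ k : Fin 3, (![(0 : ℕ), 0, 1] : Fin 3 → ℕ) k = (![(0 : ℕ), 0, 1] : Fin 3 → ℕ) 0 ↔ (k = 0 ∨ k = 1) := by
    intro k; fin_cases k <;> simp
  have hαij : w.1.embedding ((![(1 : ℂ), 1, -1] : Fin 3 → ℂ) 0) = w.1.embedding ((![(1 : ℂ), 1, -1] : Fin 3 → ℂ) 1) := by rw [hemb, hemb]; rfl
  have key := iteratedDeriv_two_integral_wallLine_eq_integral_third_trace_sub_gradient ℂ 3 (![(1 : ℂ), 1, -1] : Fin 3 → ℂ) w hα hreal (![(0 : ℕ), 0, 1] : Fin 3 → ℕ) hsign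
    ν Θ hΘ hfc (![ζ * Circle.exp t, ζ * Circle.exp t, ζ * Circle.exp (-2 * t)] : Fin 3 → Circle) hζ (i := 0) (j := 1) (by decide) rfl hb hαij
  -- transport of the left side: the wall-line orbital integrals agree pointwise in `y`
  have hL : (fun y : ℝ => ∫ g : archLocal ℂ 3 (Matrix.diagonal (![(1 : ℂ), 1, -1] : Fin 3 → ℂ)) w,
      Θ ((((g * ⟨circleDiagonal 3 (fun k => (![ζ * Circle.exp t, ζ * Circle.exp t, ζ * Circle.exp (-2 * t)] : Fin 3 → Circle) k * Circle.exp (y * ((if k = (0 : Fin 3) then 1 else 0) - (if k = (1 : Fin 3) then 1 else 0)))),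
        circleDiagonal_mem_archLocal_diagonal ℂ 3 (![(1 : ℂ), 1, -1] : Fin 3 → ℂ) w _⟩ * g⁻¹ : archLocal ℂ 3 (Matrix.diagonal (![(1 : ℂ), 1, -1] : Fin 3 → ℂ)) w) : GL (Fin 3) ℂ) : Matrix (Fin 3) (Fin 3) ℂ)) ∂ν) =
      fun y : ℝ => ∫ u : U21, Θ (mat u * Matrix.diagonal (fun k : Fin 3 => (((![ζ * Circle.exp t, ζ * Circle.exp t, ζ * Circle.exp (-2 * t)] : Fin 3 → Circle) k *
          Circle.exp (y * ((if k = (0 : Fin 3) then (1 : ℝ) else 0) - (if k = (1 : Fin 3) then (1 : ℝ) else 0))) : Circle) : ℂ)) * mat u⁻¹) ∂μ := by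
    funext y
    rw [integral_comp_conj_eq_integral_map_of_conj_frame ℂ (![(1 : ℂ), 1, -1] : Fin 3 → ℂ) w 1 e he ν Θ _, hνe]
    refine integral_congr_ae (Filter.Eventually.of_forall fun u => ?_)
    show Θ _ = Θ _
    congr 1
    rw [mat_mul, mat_mul, show mat (e ⟨circleDiagonal 3 _, circleDiagonal_mem_archLocal_diagonal ℂ 3 (![(1 : ℂ), 1, -1] : Fin 3 → ℂ) w _⟩) =
      (((e ⟨circleDiagonal 3 _, circleDiagonal_mem_archLocal_diagonal ℂ 3 (![(1 : ℂ), 1, -1] : Fin 3 → ℂ) w _⟩ : U21) : GL (Fin 3) ℂ) : Matrix (Fin 3) (Fin 3) ℂ) from rfl, he]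
    simp only [inv_one, one_mul, mul_one, coe_circleDiagonal, Units.val_one]
  -- transport of the right side: the bracket integrals agree
  have hdiag : Matrix.diagonal (fun k : Fin 3 => (((![ζ * Circle.exp t, ζ * Circle.exp t, ζ * Circle.exp (-2 * t)] : Fin 3 → Circle) k : Circle) : ℂ)) = Matrix.diagonal ![((ζ * Circle.exp t : Circle) : ℂ), ((ζ * Circle.exp t : Circle) : ℂ), ((ζ * Circle.exp (-2 * t) : Circle) : ℂ)] := by
    congr 1; funext k; fin_cases k <;> rfl
  have hcoe : (e.symm.toHomeomorph.toMeasurableEquiv : U21 → archLocal ℂ 3 (Matrix.diagonal (![(1 : ℂ), 1, -1] : Fin 3 → ℂ)) w) = e.symm := rfl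
  rw [hL] at key
  rw [key, hν, ← hcoe, integral_map_equiv]
  refine integral_congr_ae (Filter.Eventually.of_forall fun u => ?_)
  simp only [hcoe]
  have hg : (((e.symm u : archLocal ℂ 3 (Matrix.diagonal (![(1 : ℂ), 1, -1] : Fin 3 → ℂ)) w) : GL (Fin 3) ℂ) : Matrix (Fin 3) (Fin 3) ℂ) = mat u := by rw [hes]
  have hginv : ((((e.symm u)⁻¹ : archLocal ℂ 3 (Matrix.diagonal (![(1 : ℂ), 1, -1] : Fin 3 → ℂ)) w) : GL (Fin 3) ℂ) : Matrix (Fin 3) (Fin 3) ℂ) = mat u⁻¹ := by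
    rw [Subgroup.coe_inv, hes]; rfl
  have hconj : ((((e.symm u) * ⟨circleDiagonal 3 (![ζ * Circle.exp t, ζ * Circle.exp t, ζ * Circle.exp (-2 * t)] : Fin 3 → Circle), circleDiagonal_mem_archLocal_diagonal ℂ 3 (![(1 : ℂ), 1, -1] : Fin 3 → ℂ) w _⟩ * (e.symm u)⁻¹ : archLocal ℂ 3 (Matrix.diagonal (![(1 : ℂ), 1, -1] : Fin 3 → ℂ)) w) : GL (Fin 3) ℂ) : Matrix (Fin 3) (Fin 3) ℂ) =
      (mat (u * mkU21 (Matrix.diagonal ![((ζ * Circle.exp t : Circle) : ℂ), ((ζ * Circle.exp t : Circle) : ℂ), ((ζ * Circle.exp (-2 * t) : Circle) : ℂ)]) (diagonal_uuv_preserves (ζ * Circle.exp t) (ζ * Circle.exp (-2 * t))) * u⁻¹)) := by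
    rw [Subgroup.coe_mul, Subgroup.coe_mul, Units.val_mul, Units.val_mul, hg, hginv, coe_circleDiagonal, hdiag, mat_mul, mat_mul, mat_mkU21]
  rw [hconj, hg, hginv]
  simp only [Matrix.cons_val_zero]

end Trace

/-! ### §4 The one-sided jets of `𝓘_χ(t) = ∫ Λ_χ(t, W, √(2 sin(3t∕2)+|W|²)) d⁴W` at `t = 0` (★ generic ENGINE-T jets at the datum `Λ_χ`) -/

section Jets

variable {G : Type*} [NormedAddCommGroup G] [NormedSpace ℝ G]

/-- **THE FIRST ONE-SIDED JET OF `𝓘_χ`** (`ε(0) = 0`, `ε′(0) = 3`): `𝓘_χ′(0⁺) = ∫ DΛ_χ(0, W, |W|)[(1, 0, 3∕(2|W|))] d⁴W` — ★ `derivWithin_integral_family_zero` at (★ `contDiff_two_transversalDatum`,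
★ `exists_sq_support_bound_transversalDatum`), verbatim as ★ `derivWithin_wallCurve_sheetIntegral_zero` for `ψ`. [cite: Rogawski1990, §8.4 pp. 126–127] [cite: Rudin1980, §1.4] -/
theorem derivWithin_transversal_sheetIntegral_zero (Θ : Matrix (Fin 3) (Fin 3) ℂ → G) (hΘ : ContDiff ℝ 4 Θ) (hΘc : HasCompactSupport Θ) (ζ : Circle)
    {δ : ℝ} (hδ : 0 < δ) (hδ' : δ < 2 * Real.pi / 3) :
    derivWithin (fun t : ℝ => ∫ W : Fin 2 → ℂ,
        ((1 / 3 : ℝ) • ((∑ k, ∑ l, ((J k k * J l l).re • (iteratedFDeriv ℝ 2 Θ (((ζ * Circle.exp t : Circle) : ℂ) • (1 : Matrix (Fin 3) (Fin 3) ℂ) + (I * (ζ : ℂ) * Complex.exp (-(t / 2 : ℝ) * I)) • (vecMulVec ![W 0, W 1, (Real.sqrt (2 * Real.sin (3 * t / 2) + nsq W) : ℂ)] (star ![W 0, W 1, (Real.sqrt (2 * Real.sin (3 * t / 2) + nsq W) : ℂ)]) * J)) ![((ζ * Circle.exp t : Circle) : ℂ) • (Matrix.single k l (1 : ℂ) *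 (((Real.sqrt (2 * Real.sin (3 * t / 2) + nsq W) ^ 2 - nsq W : ℝ) : ℂ) • (1 : Matrix (Fin 3) (Fin 3) ℂ) + (vecMulVec ![W 0, W 1, (Real.sqrt (2 * Real.sin (3 * t / 2) + nsq W) : ℂ)] (star ![W 0, W 1, (Real.sqrt (2 * Real.sin (3 * t / 2) + nsq W) : ℂ)]) * J))), ((ζ * Circle.exp t : Circle) : ℂ) • ((((Real.sqrt (2 * Real.sin (3 * t / 2) + nsq W) ^ 2 - nsq W : ℝ) : ℂ) • (1 : Matrix (Fin 3) (Fin 3) ℂ) + (vecMulVec ![W 0, W 1, (Real.sqrt (2 * Real.sin (3 * t / 2) + nsq W) : ℂ)] (star ![W 0, W 1, (Real.sqrt (2 * Real.sin (3 * t / 2) + nsq W) : ℂ)]) * J)) * Matrix.single k l (1 : ℂ))] +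
                  iteratedFDeriv ℝ 2 Θ (((ζ * Circle.exp t : Circle) : ℂ) • (1 : Matrix (Fin 3) (Fin 3) ℂ) + (I * (ζ : ℂ) * Complex.exp (-(t / 2 : ℝ) * I)) • (vecMulVec ![W 0, W 1, (Real.sqrt (2 * Real.sin (3 * t / 2) + nsq W) : ℂ)] (star ![W 0, W 1, (Real.sqrt (2 * Real.sin (3 * t / 2) + nsq W) : ℂ)]) * J)) ![((ζ * Circle.exp t : Circle) : ℂ) • (I • (Matrix.single k l (1 : ℂ) * (((Real.sqrt (2 * Real.sin (3 * t / 2) + nsq W) ^ 2 - nsq W : ℝ) : ℂ) • (1 : Matrix (Fin 3) (Fin 3) ℂ) + (vecMulVec ![W 0, W 1, (Real.sqrt (2 * Real.sin (3 * t / 2) + nsq W) : ℂ)] (star ![W 0, W 1, (Real.sqrt (2 * Real.sin (3 * t / 2) + nsq W) : ℂ)]) * J)))), ((ζ * Circle.exp t : Circle) : ℂ) • (I • ((((Real.sqrt (2 * Real.sin (3 * t / 2) + nsq W) ^ 2 - nsq W : ℝ) : ℂ) • (1 : Matrix (Fin 3) (Fin 3) ℂ) + (vecMulVec ![W 0, W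 1, (Real.sqrt (2 * Real.sin (3 * t / 2) + nsq W) : ℂ)] (star ![W 0, W 1, (Real.sqrt (2 * Real.sin (3 * t / 2) + nsq W) : ℂ)]) * J)) * Matrix.single k l (1 : ℂ)))]) -
                iteratedFDeriv ℝ 2 Θ (((ζ * Circle.exp t : Circle) : ℂ) • (1 : Matrix (Fin 3) (Fin 3) ℂ) + (I * (ζ : ℂ) * Complex.exp (-(t / 2 : ℝ) * I)) • (vecMulVec ![W 0, W 1, (Real.sqrt (2 * Real.sin (3 * t / 2) + nsq W) : ℂ)] (star ![W 0, W 1, (Real.sqrt (2 * Real.sin (3 * t / 2) + nsq W) : ℂ)]) * J)) ![((ζ * Circle.exp t : Circle) : ℂ) • (Matrix.single k l (1 : ℂ) * (((Real.sqrt (2 * Real.sin (3 * t / 2) + nsq W) ^ 2 - nsq W : ℝ) : ℂ) • (1 : Matrix (Fin 3) (Fin 3) ℂ) + (vecMulVec ![W 0, W 1, (Real.sqrt (2 * Real.sin (3 * t / 2) + nsq W) : ℂ)] (star ![W 0, W 1, (Real.sqrt (2 * Real.sin (3 * t / 2) + nsq W) : ℂ)]) * J))), ((ζ * Circle.exp t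 : Circle) : ℂ) • (Matrix.single l k (1 : ℂ) * (((Real.sqrt (2 * Real.sin (3 * t / 2) + nsq W) ^ 2 - nsq W : ℝ) : ℂ) • (1 : Matrix (Fin 3) (Fin 3) ℂ) + (vecMulVec ![W 0, W 1, (Real.sqrt (2 * Real.sin (3 * t / 2) + nsq W) : ℂ)] (star ![W 0, W 1, (Real.sqrt (2 * Real.sin (3 * t / 2) + nsq W) : ℂ)]) * J)))] +
                iteratedFDeriv ℝ 2 Θ (((ζ * Circle.exp t : Circle) : ℂ) • (1 : Matrix (Fin 3) (Fin 3) ℂ) + (I * (ζ : ℂ) * Complex.exp (-(t / 2 : ℝ) * I)) • (vecMulVec ![W 0, W 1, (Real.sqrt (2 * Real.sin (3 * t / 2) + nsq W) : ℂ)] (star ![W 0, W 1, (Real.sqrt (2 * Real.sin (3 * t / 2) + nsq W) : ℂ)]) * J)) ![((ζ * Circle.exp t : Circle) : ℂ) • (I • (Matrix.single k l (1 : ℂ) * (((Real.sqrt (2 * Real.sin (3 * t / 2) + nsq W) ^ 2 - nsq W : ℝ) : ℂ) • (1 : Matrix (Fin 3) (Fin 3) ℂ) + (vecMulVec ![W 0,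 W 1, (Real.sqrt (2 * Real.sin (3 * t / 2) + nsq W) : ℂ)] (star ![W 0, W 1, (Real.sqrt (2 * Real.sin (3 * t / 2) + nsq W) : ℂ)]) * J)))), ((ζ * Circle.exp t : Circle) : ℂ) • (I • (Matrix.single l k (1 : ℂ) * (((Real.sqrt (2 * Real.sin (3 * t / 2) + nsq W) ^ 2 - nsq W : ℝ) : ℂ) • (1 : Matrix (Fin 3) (Fin 3) ℂ) + (vecMulVec ![W 0, W 1, (Real.sqrt (2 * Real.sin (3 * t / 2) + nsq W) : ℂ)] (star ![W 0, W 1, (Real.sqrt (2 * Real.sin (3 * t / 2) + nsq W) : ℂ)]) * J))))])) -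
              iteratedFDeriv ℝ 2 Θ (((ζ * Circle.exp t : Circle) : ℂ) • (1 : Matrix (Fin 3) (Fin 3) ℂ) + (I * (ζ : ℂ) * Complex.exp (-(t / 2 : ℝ) * I)) • (vecMulVec ![W 0, W 1, (Real.sqrt (2 * Real.sin (3 * t / 2) + nsq W) : ℂ)] (star ![W 0, W 1, (Real.sqrt (2 * Real.sin (3 * t / 2) + nsq W) : ℂ)]) * J)) ![((ζ * Circle.exp t : Circle) : ℂ) • (I • (((Real.sqrt (2 * Real.sin (3 * t / 2) + nsq W) ^ 2 - nsq W : ℝ) : ℂ) • (1 : Matrix (Fin 3) (Fin 3) ℂ) + (vecMulVec ![W 0, W 1, (Real.sqrt (2 * Real.sin (3 * t / 2) + nsq W) : ℂ)] (star ![W 0, W 1, (Real.sqrt (2 * Real.sin (3 * t / 2) + nsq W) : ℂ)]) * J))), ((ζ * Circle.exp t : Circle) : ℂ) • (I • (((Real.sqrt (2 * Real.sin (3 * t / 2) + nsq W) ^ 2 - nsq W : ℝ) : ℂ) • (1 : Matrix (Fin 3) (Fin 3) ℂ) + (vecMulVec ![W 0, W 1, (Real.sqrt (2 * Real.sin (3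 * t / 2) + nsq W) : ℂ)] (star ![W 0, W 1, (Real.sqrt (2 * Real.sin (3 * t / 2) + nsq W) : ℂ)]) * J)))]) -
            (Real.sqrt (2 * Real.sin (3 * t / 2) + nsq W) ^ 2 - nsq W) • fderiv ℝ Θ (((ζ * Circle.exp t : Circle) : ℂ) • (1 : Matrix (Fin 3) (Fin 3) ℂ) + (I * (ζ : ℂ) * Complex.exp (-(t / 2 : ℝ) * I)) • (vecMulVec ![W 0, W 1, (Real.sqrt (2 * Real.sin (3 * t / 2) + nsq W) : ℂ)] (star ![W 0, W 1, (Real.sqrt (2 * Real.sin (3 * t / 2) + nsq W) : ℂ)]) * J)) (((ζ * Circle.exp t : Circle) : ℂ) • (((Real.sqrt (2 * Real.sin (3 * t / 2) + nsq W) ^ 2 - nsq W : ℝ) : ℂ) • (1 : Matrix (Fin 3) (Fin 3) ℂ) + (vecMulVec ![W 0, W 1, (Real.sqrt (2 * Real.sin (3 * t / 2) + nsq W) : ℂ)] (star ![W 0, W 1, (Real.sqrt (2 * Real.sin (3 * t / 2) + nsq W) : ℂ)]) * J))))) (Icc 0 δ) 0 =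
      ∫ W : Fin 2 → ℂ, (fderiv ℝ (fun p : ℝ × (Fin 2 → ℂ) × ℝ =>
          ((1 / 3 : ℝ) • ((∑ k, ∑ l, ((J k k * J l l).re • (iteratedFDeriv ℝ 2 Θ (((ζ * Circle.exp p.1 : Circle) : ℂ) • (1 : Matrix (Fin 3) (Fin 3) ℂ) + (I * (ζ : ℂ) * Complex.exp (-(p.1 / 2 : ℝ) * I)) • (vecMulVec ![p.2.1 0, p.2.1 1, (p.2.2 : ℂ)] (star ![p.2.1 0, p.2.1 1, (p.2.2 : ℂ)]) * J)) ![((ζ * Circle.exp p.1 : Circle) : ℂ) • (Matrix.single k l (1 : ℂ) * (((p.2.2 ^ 2 - nsq p.2.1 : ℝ) : ℂ) • (1 : Matrix (Fin 3) (Fin 3) ℂ) + (vecMulVec ![p.2.1 0, p.2.1 1, (p.2.2 : ℂ)] (star ![p.2.1 0, p.2.1 1, (p.2.2 : ℂ)]) * J))), ((ζ * Circle.exp p.1 : Circle) : ℂ) • ((((p.2.2 ^ 2 - nsq p.2.1 : ℝ) : ℂ) • (1 : Matrix (Fin 3) (Fin 3) ℂ) + (vecMulVec ![p.2.1 0, p.2.1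 1, (p.2.2 : ℂ)] (star ![p.2.1 0, p.2.1 1, (p.2.2 : ℂ)]) * J)) * Matrix.single k l (1 : ℂ))] +
                  iteratedFDeriv ℝ 2 Θ (((ζ * Circle.exp p.1 : Circle) : ℂ) • (1 : Matrix (Fin 3) (Fin 3) ℂ) + (I * (ζ : ℂ) * Complex.exp (-(p.1 / 2 : ℝ) * I)) • (vecMulVec ![p.2.1 0, p.2.1 1, (p.2.2 : ℂ)] (star ![p.2.1 0, p.2.1 1, (p.2.2 : ℂ)]) * J)) ![((ζ * Circle.exp p.1 : Circle) : ℂ) • (I • (Matrix.single k l (1 : ℂ) * (((p.2.2 ^ 2 - nsq p.2.1 : ℝ) : ℂ) • (1 : Matrix (Fin 3) (Fin 3) ℂ) + (vecMulVec ![p.2.1 0, p.2.1 1, (p.2.2 : ℂ)] (star ![p.2.1 0, p.2.1 1, (p.2.2 : ℂ)]) * J)))), ((ζ * Circle.exp p.1 : Circle) : ℂ) • (I • ((((p.2.2 ^ 2 - nsq p.2.1 : ℝ) : ℂ) • (1 : Matrix (Fin 3) (Fin 3) ℂ) + (vecMulVec ![p.2.1 0, p.2.1 1, (p.2.2 : ℂ)]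 (star ![p.2.1 0, p.2.1 1, (p.2.2 : ℂ)]) * J)) * Matrix.single k l (1 : ℂ)))]) -
                iteratedFDeriv ℝ 2 Θ (((ζ * Circle.exp p.1 : Circle) : ℂ) • (1 : Matrix (Fin 3) (Fin 3) ℂ) + (I * (ζ : ℂ) * Complex.exp (-(p.1 / 2 : ℝ) * I)) • (vecMulVec ![p.2.1 0, p.2.1 1, (p.2.2 : ℂ)] (star ![p.2.1 0, p.2.1 1, (p.2.2 : ℂ)]) * J)) ![((ζ * Circle.exp p.1 : Circle) : ℂ) • (Matrix.single k l (1 : ℂ) * (((p.2.2 ^ 2 - nsq p.2.1 : ℝ) : ℂ) • (1 : Matrix (Fin 3) (Fin 3) ℂ) + (vecMulVec ![p.2.1 0, p.2.1 1, (p.2.2 : ℂ)] (star ![p.2.1 0, p.2.1 1, (p.2.2 : ℂ)]) * J))), ((ζ * Circle.exp p.1 : Circle) : ℂ) • (Matrix.single l k (1 : ℂ) * (((p.2.2 ^ 2 - nsq p.2.1 : ℝ) : ℂ) • (1 : Matrix (Fin 3) (Fin 3) ℂ) + (vecMulVec ![p.2.1 0, p.2.1 1, (p.2.2 : ℂ)]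 (star ![p.2.1 0, p.2.1 1, (p.2.2 : ℂ)]) * J)))] +
                iteratedFDeriv ℝ 2 Θ (((ζ * Circle.exp p.1 : Circle) : ℂ) • (1 : Matrix (Fin 3) (Fin 3) ℂ) + (I * (ζ : ℂ) * Complex.exp (-(p.1 / 2 : ℝ) * I)) • (vecMulVec ![p.2.1 0, p.2.1 1, (p.2.2 : ℂ)] (star ![p.2.1 0, p.2.1 1, (p.2.2 : ℂ)]) * J)) ![((ζ * Circle.exp p.1 : Circle) : ℂ) • (I • (Matrix.single k l (1 : ℂ) * (((p.2.2 ^ 2 - nsq p.2.1 : ℝ) : ℂ) • (1 : Matrix (Fin 3) (Fin 3) ℂ) + (vecMulVec ![p.2.1 0, p.2.1 1, (p.2.2 : ℂ)] (star ![p.2.1 0, p.2.1 1, (p.2.2 : ℂ)]) * J)))), ((ζ * Circle.exp p.1 : Circle) : ℂ) • (I • (Matrix.single l k (1 : ℂ) * (((p.2.2 ^ 2 - nsq p.2.1 : ℝ) : ℂ) • (1 : Matrix (Fin 3) (Fin 3) ℂ) + (vecMulVec ![p.2.1 0, p.2.1 1, (p.2.2 : ℂ)] (star ![p.2.1 0,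 p.2.1 1, (p.2.2 : ℂ)]) * J))))])) -
              iteratedFDeriv ℝ 2 Θ (((ζ * Circle.exp p.1 : Circle) : ℂ) • (1 : Matrix (Fin 3) (Fin 3) ℂ) + (I * (ζ : ℂ) * Complex.exp (-(p.1 / 2 : ℝ) * I)) • (vecMulVec ![p.2.1 0, p.2.1 1, (p.2.2 : ℂ)] (star ![p.2.1 0, p.2.1 1, (p.2.2 : ℂ)]) * J)) ![((ζ * Circle.exp p.1 : Circle) : ℂ) • (I • (((p.2.2 ^ 2 - nsq p.2.1 : ℝ) : ℂ) • (1 : Matrix (Fin 3) (Fin 3) ℂ) + (vecMulVec ![p.2.1 0, p.2.1 1, (p.2.2 : ℂ)] (star ![p.2.1 0, p.2.1 1, (p.2.2 : ℂ)]) * J))), ((ζ * Circle.exp p.1 : Circle) : ℂ) • (I • (((p.2.2 ^ 2 - nsq p.2.1 : ℝ) : ℂ) • (1 : Matrix (Fin 3) (Fin 3) ℂ) + (vecMulVec ![p.2.1 0, p.2.1 1, (p.2.2 : ℂ)] (star ![p.2.1 0, p.2.1 1, (p.2.2 : ℂ)]) * J)))]) -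
            (p.2.2 ^ 2 - nsq p.2.1) • fderiv ℝ Θ (((ζ * Circle.exp p.1 : Circle) : ℂ) • (1 : Matrix (Fin 3) (Fin 3) ℂ) + (I * (ζ : ℂ) * Complex.exp (-(p.1 / 2 : ℝ) * I)) • (vecMulVec ![p.2.1 0, p.2.1 1, (p.2.2 : ℂ)] (star ![p.2.1 0, p.2.1 1, (p.2.2 : ℂ)]) * J)) (((ζ * Circle.exp p.1 : Circle) : ℂ) • (((p.2.2 ^ 2 - nsq p.2.1 : ℝ) : ℂ) • (1 : Matrix (Fin 3) (Fin 3) ℂ) + (vecMulVec ![p.2.1 0, p.2.1 1, (p.2.2 : ℂ)] (star ![p.2.1 0, p.2.1 1, (p.2.2 : ℂ)]) * J)))))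
          (0, W, Real.sqrt (2 * Real.sin (3 * (0 : ℝ) / 2) + nsq W))) ((1 : ℝ), (0 : Fin 2 → ℂ), 3 * Real.cos (3 * (0 : ℝ) / 2) * (2 * Real.sqrt (2 * Real.sin (3 * (0 : ℝ) / 2) + nsq W))⁻¹) := by
  obtain ⟨S, hS⟩ := exists_sq_support_bound_transversalDatum Θ hΘc ζ
  have hε₁c : Continuous fun t : ℝ => 3 * Real.cos (3 * t / 2) := by fun_prop
  exact derivWithin_integral_family_zero (T := 2 * Real.pi / 3)
    (Λ := (fun p : ℝ × (Fin 2 → ℂ) × ℝ =>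
          ((1 / 3 : ℝ) • ((∑ k, ∑ l, ((J k k * J l l).re • (iteratedFDeriv ℝ 2 Θ (((ζ * Circle.exp p.1 : Circle) : ℂ) • (1 : Matrix (Fin 3) (Fin 3) ℂ) + (I * (ζ : ℂ) * Complex.exp (-(p.1 / 2 : ℝ) * I)) • (vecMulVec ![p.2.1 0, p.2.1 1, (p.2.2 : ℂ)] (star ![p.2.1 0, p.2.1 1, (p.2.2 : ℂ)]) * J)) ![((ζ * Circle.exp p.1 : Circle) : ℂ) • (Matrix.single k l (1 : ℂ) * (((p.2.2 ^ 2 - nsq p.2.1 : ℝ) : ℂ) • (1 : Matrix (Fin 3) (Fin 3) ℂ) + (vecMulVec ![p.2.1 0, p.2.1 1, (p.2.2 : ℂ)] (star ![p.2.1 0, p.2.1 1, (p.2.2 : ℂ)]) * J))), ((ζ * Circle.exp p.1 : Circle) : ℂ) • ((((p.2.2 ^ 2 - nsq p.2.1 : ℝ) : ℂ) • (1 : Matrix (Fin 3) (Fin 3) ℂ) + (vecMulVec ![p.2.1 0, p.2.1 1, (p.2.2 : ℂ)] (star ![p.2.1 0, p.2.1 1, (p.2.2 : ℂ)]) * J))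 * Matrix.single k l (1 : ℂ))] +
                  iteratedFDeriv ℝ 2 Θ (((ζ * Circle.exp p.1 : Circle) : ℂ) • (1 : Matrix (Fin 3) (Fin 3) ℂ) + (I * (ζ : ℂ) * Complex.exp (-(p.1 / 2 : ℝ) * I)) • (vecMulVec ![p.2.1 0, p.2.1 1, (p.2.2 : ℂ)] (star ![p.2.1 0, p.2.1 1, (p.2.2 : ℂ)]) * J)) ![((ζ * Circle.exp p.1 : Circle) : ℂ) • (I • (Matrix.single k l (1 : ℂ) * (((p.2.2 ^ 2 - nsq p.2.1 : ℝ) : ℂ) • (1 : Matrix (Fin 3) (Fin 3) ℂ) + (vecMulVec ![p.2.1 0, p.2.1 1, (p.2.2 : ℂ)] (star ![p.2.1 0, p.2.1 1, (p.2.2 : ℂ)]) * J)))), ((ζ * Circle.exp p.1 : Circle) : ℂ) • (I • ((((p.2.2 ^ 2 - nsq p.2.1 : ℝ) : ℂ) • (1 : Matrix (Fin 3) (Fin 3) ℂ) + (vecMulVec ![p.2.1 0, p.2.1 1, (p.2.2 : ℂ)] (star ![p.2.1 0, p.2.1 1, (p.2.2 : ℂ)]) * J)) * Matrix.single k l (1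 : ℂ)))]) -
                iteratedFDeriv ℝ 2 Θ (((ζ * Circle.exp p.1 : Circle) : ℂ) • (1 : Matrix (Fin 3) (Fin 3) ℂ) + (I * (ζ : ℂ) * Complex.exp (-(p.1 / 2 : ℝ) * I)) • (vecMulVec ![p.2.1 0, p.2.1 1, (p.2.2 : ℂ)] (star ![p.2.1 0, p.2.1 1, (p.2.2 : ℂ)]) * J)) ![((ζ * Circle.exp p.1 : Circle) : ℂ) • (Matrix.single k l (1 : ℂ) * (((p.2.2 ^ 2 - nsq p.2.1 : ℝ) : ℂ) • (1 : Matrix (Fin 3) (Fin 3) ℂ) + (vecMulVec ![p.2.1 0, p.2.1 1, (p.2.2 : ℂ)] (star ![p.2.1 0, p.2.1 1, (p.2.2 : ℂ)]) * J))), ((ζ * Circle.exp p.1 : Circle) : ℂ) • (Matrix.single l k (1 : ℂ) * (((p.2.2 ^ 2 - nsq p.2.1 : ℝ) : ℂ) • (1 : Matrix (Fin 3) (Fin 3) ℂ) + (vecMulVec ![p.2.1 0, p.2.1 1, (p.2.2 : ℂ)] (star ![p.2.1 0, p.2.1 1, (p.2.2 : ℂ)]) * J)))] +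
                iteratedFDeriv ℝ 2 Θ (((ζ * Circle.exp p.1 : Circle) : ℂ) • (1 : Matrix (Fin 3) (Fin 3) ℂ) + (I * (ζ : ℂ) * Complex.exp (-(p.1 / 2 : ℝ) * I)) • (vecMulVec ![p.2.1 0, p.2.1 1, (p.2.2 : ℂ)] (star ![p.2.1 0, p.2.1 1, (p.2.2 : ℂ)]) * J)) ![((ζ * Circle.exp p.1 : Circle) : ℂ) • (I • (Matrix.single k l (1 : ℂ) * (((p.2.2 ^ 2 - nsq p.2.1 : ℝ) : ℂ) • (1 : Matrix (Fin 3) (Fin 3) ℂ) + (vecMulVec ![p.2.1 0, p.2.1 1, (p.2.2 : ℂ)] (star ![p.2.1 0, p.2.1 1, (p.2.2 : ℂ)]) * J)))), ((ζ * Circle.exp p.1 : Circle) : ℂ) • (I • (Matrix.single l k (1 : ℂ) * (((p.2.2 ^ 2 - nsq p.2.1 : ℝ) : ℂ) • (1 : Matrix (Fin 3) (Fin 3) ℂ) + (vecMulVec ![p.2.1 0, p.2.1 1, (p.2.2 : ℂ)] (star ![p.2.1 0, p.2.1 1, (p.2.2 : ℂ)]) * J))))])) -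
              iteratedFDeriv ℝ 2 Θ (((ζ * Circle.exp p.1 : Circle) : ℂ) • (1 : Matrix (Fin 3) (Fin 3) ℂ) + (I * (ζ : ℂ) * Complex.exp (-(p.1 / 2 : ℝ) * I)) • (vecMulVec ![p.2.1 0, p.2.1 1, (p.2.2 : ℂ)] (star ![p.2.1 0, p.2.1 1, (p.2.2 : ℂ)]) * J)) ![((ζ * Circle.exp p.1 : Circle) : ℂ) • (I • (((p.2.2 ^ 2 - nsq p.2.1 : ℝ) : ℂ) • (1 : Matrix (Fin 3) (Fin 3) ℂ) + (vecMulVec ![p.2.1 0, p.2.1 1, (p.2.2 : ℂ)] (star ![p.2.1 0, p.2.1 1, (p.2.2 : ℂ)]) * J))), ((ζ * Circle.exp p.1 : Circle) : ℂ) • (I • (((p.2.2 ^ 2 - nsq p.2.1 : ℝ) : ℂ) • (1 : Matrix (Fin 3) (Fin 3) ℂ) + (vecMulVec ![p.2.1 0, p.2.1 1, (p.2.2 : ℂ)] (star ![p.2.1 0, p.2.1 1, (p.2.2 : ℂ)]) * J)))]) -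
            (p.2.2 ^ 2 - nsq p.2.1) • fderiv ℝ Θ (((ζ * Circle.exp p.1 : Circle) : ℂ) • (1 : Matrix (Fin 3) (Fin 3) ℂ) + (I * (ζ : ℂ) * Complex.exp (-(p.1 / 2 : ℝ) * I)) • (vecMulVec ![p.2.1 0, p.2.1 1, (p.2.2 : ℂ)] (star ![p.2.1 0, p.2.1 1, (p.2.2 : ℂ)]) * J)) (((ζ * Circle.exp p.1 : Circle) : ℂ) • (((p.2.2 ^ 2 - nsq p.2.1 : ℝ) : ℂ) • (1 : Matrix (Fin 3) (Fin 3) ℂ) + (vecMulVec ![p.2.1 0, p.2.1 1, (p.2.2 : ℂ)] (star ![p.2.1 0, p.2.1 1, (p.2.2 : ℂ)]) * J))))))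
    (ε := fun t : ℝ => 2 * Real.sin (3 * t / 2)) (ε₁ := fun t : ℝ => 3 * Real.cos (3 * t / 2))
    (contDiff_two_transversalDatum Θ hΘ ζ) hS hasDerivAt_wallRadius hε₁c (fun t ht => wallRadius_nonneg ht) (fun t ht => wallRadius_pos ht) hδ hδ'

/-- **THE SECOND ONE-SIDED JET OF `𝓘_χ`** (`ε(0) = 0`, `ε′(0) = 3`, `ε″(0) = 0`): `𝓘_χ″(0⁺) = ∫ D²Λ_χ(0,W,|W|)[(1,0,3∕(2|W|))]² + DΛ_χ(0,W,|W|)[(0,0,ε″(0)∕(2|W|) − 9∕(4|W|³))] d⁴W` — ★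
`iteratedDerivWithin_two_integral_family_zero` at the datum `Λ_χ` (the `χ″(0⁺)` of ★ (A4)-V ∕ (A4)-I, up to the constant `c` of ★ `exists_wallGerm_chi`; the wall-radius jets `ε(0), ε′(0), ε″(0)` are
left unsimplified, ★ `wallRadius_jets_zero`). [cite: Rogawski1990, §8.4 pp. 126–127] [cite: Rudin1980, §1.4] -/
theorem iteratedDerivWithin_two_transversal_sheetIntegral_zero (Θ : Matrix (Fin 3) (Fin 3) ℂ → G) (hΘ : ContDiff ℝ 4 Θ) (hΘc : HasCompactSupport Θ) (ζ : Circle)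
    {δ : ℝ} (hδ : 0 < δ) (hδ' : δ < 2 * Real.pi / 3) :
    iteratedDerivWithin 2 (fun t : ℝ => ∫ W : Fin 2 → ℂ,
        ((1 / 3 : ℝ) • ((∑ k, ∑ l, ((J k k * J l l).re • (iteratedFDeriv ℝ 2 Θ (((ζ * Circle.exp t : Circle) : ℂ) • (1 : Matrix (Fin 3) (Fin 3) ℂ) + (I * (ζ : ℂ) * Complex.exp (-(t / 2 : ℝ) * I)) • (vecMulVec ![W 0, W 1, (Real.sqrt (2 * Real.sin (3 * t / 2) + nsq W) : ℂ)] (star ![W 0, W 1, (Real.sqrt (2 * Real.sin (3 * t / 2) + nsq W) : ℂ)]) * J)) ![((ζ * Circle.exp t : Circle) : ℂ) • (Matrix.single k l (1 : ℂ) * (((Real.sqrt (2 * Real.sin (3 * t / 2) + nsq W) ^ 2 - nsq W : ℝ) : ℂ) • (1 : Matrix (Fin 3) (Fin 3) ℂ) + (vecMulVec ![W 0, W 1, (Real.sqrt (2 * Real.sin (3 * t / 2) + nsq W) : ℂ)] (star ![W 0, W 1, (Real.sqrt (2 * Real.sin (3 * t / 2) + nsq W) : ℂ)]) * J))), ((ζ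 * Circle.exp t : Circle) : ℂ) • ((((Real.sqrt (2 * Real.sin (3 * t / 2) + nsq W) ^ 2 - nsq W : ℝ) : ℂ) • (1 : Matrix (Fin 3) (Fin 3) ℂ) + (vecMulVec ![W 0, W 1, (Real.sqrt (2 * Real.sin (3 * t / 2) + nsq W) : ℂ)] (star ![W 0, W 1, (Real.sqrt (2 * Real.sin (3 * t / 2) + nsq W) : ℂ)]) * J)) * Matrix.single k l (1 : ℂ))] +
                  iteratedFDeriv ℝ 2 Θ (((ζ * Circle.exp t : Circle) : ℂ) • (1 : Matrix (Fin 3) (Fin 3) ℂ) + (I * (ζ : ℂ) * Complex.exp (-(t / 2 : ℝ) * I)) • (vecMulVec ![W 0, W 1, (Real.sqrt (2 * Real.sin (3 * t / 2) + nsq W) : ℂ)] (star ![W 0, W 1, (Real.sqrt (2 * Real.sin (3 * t / 2) + nsq W) : ℂ)]) * J)) ![((ζ * Circle.exp t : Circle) : ℂ) • (I • (Matrix.single k l (1 : ℂ) * (((Real.sqrt (2 * Real.sin (3 * t / 2) + nsq W) ^ 2 - nsq W : ℝ) : ℂ) • (1 : Matrix (Fin 3) (Fin 3) ℂ) + (vecMulVec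 ![W 0, W 1, (Real.sqrt (2 * Real.sin (3 * t / 2) + nsq W) : ℂ)] (star ![W 0, W 1, (Real.sqrt (2 * Real.sin (3 * t / 2) + nsq W) : ℂ)]) * J)))), ((ζ * Circle.exp t : Circle) : ℂ) • (I • ((((Real.sqrt (2 * Real.sin (3 * t / 2) + nsq W) ^ 2 - nsq W : ℝ) : ℂ) • (1 : Matrix (Fin 3) (Fin 3) ℂ) + (vecMulVec ![W 0, W 1, (Real.sqrt (2 * Real.sin (3 * t / 2) + nsq W) : ℂ)] (star ![W 0, W 1, (Real.sqrt (2 * Real.sin (3 * t / 2) + nsq W) : ℂ)]) * J)) * Matrix.single k l (1 : ℂ)))]) -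
                iteratedFDeriv ℝ 2 Θ (((ζ * Circle.exp t : Circle) : ℂ) • (1 : Matrix (Fin 3) (Fin 3) ℂ) + (I * (ζ : ℂ) * Complex.exp (-(t / 2 : ℝ) * I)) • (vecMulVec ![W 0, W 1, (Real.sqrt (2 * Real.sin (3 * t / 2) + nsq W) : ℂ)] (star ![W 0, W 1, (Real.sqrt (2 * Real.sin (3 * t / 2) + nsq W) : ℂ)]) * J)) ![((ζ * Circle.exp t : Circle) : ℂ) • (Matrix.single k l (1 : ℂ) * (((Real.sqrt (2 * Real.sin (3 * t / 2) + nsq W) ^ 2 - nsq W : ℝ) : ℂ) • (1 : Matrix (Fin 3) (Fin 3) ℂ) + (vecMulVec ![W 0, W 1, (Real.sqrt (2 * Real.sin (3 * t / 2) + nsq W) : ℂ)] (star ![W 0, W 1, (Real.sqrt (2 * Real.sin (3 * t / 2) + nsq W) : ℂ)]) * J))), ((ζ * Circle.exp t : Circle) : ℂ) • (Matrix.single l k (1 : ℂ) * (((Real.sqrt (2 * Real.sin (3 * t / 2) + nsq W) ^ 2 - nsq W : ℝ) : ℂ) • (1 : Matrix (Fin 3) (Fin 3) ℂ) + (vecMulVec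 ![W 0, W 1, (Real.sqrt (2 * Real.sin (3 * t / 2) + nsq W) : ℂ)] (star ![W 0, W 1, (Real.sqrt (2 * Real.sin (3 * t / 2) + nsq W) : ℂ)]) * J)))] +
                iteratedFDeriv ℝ 2 Θ (((ζ * Circle.exp t : Circle) : ℂ) • (1 : Matrix (Fin 3) (Fin 3) ℂ) + (I * (ζ : ℂ) * Complex.exp (-(t / 2 : ℝ) * I)) • (vecMulVec ![W 0, W 1, (Real.sqrt (2 * Real.sin (3 * t / 2) + nsq W) : ℂ)] (star ![W 0, W 1, (Real.sqrt (2 * Real.sin (3 * t / 2) + nsq W) : ℂ)]) * J)) ![((ζ * Circle.exp t : Circle) : ℂ) • (I • (Matrix.single k l (1 : ℂ) * (((Real.sqrt (2 * Real.sin (3 * t / 2) + nsq W) ^ 2 - nsq W : ℝ) : ℂ) • (1 : Matrix (Fin 3) (Fin 3) ℂ) + (vecMulVec ![W 0, W 1, (Real.sqrt (2 * Real.sin (3 * t / 2) + nsq W) : ℂ)] (star ![W 0, W 1, (Real.sqrt (2 * Real.sin (3 * t / 2) + nsq W) : ℂ)]) * J)))), ((ζ * Circle.exp t : Circle) : ℂ)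 • (I • (Matrix.single l k (1 : ℂ) * (((Real.sqrt (2 * Real.sin (3 * t / 2) + nsq W) ^ 2 - nsq W : ℝ) : ℂ) • (1 : Matrix (Fin 3) (Fin 3) ℂ) + (vecMulVec ![W 0, W 1, (Real.sqrt (2 * Real.sin (3 * t / 2) + nsq W) : ℂ)] (star ![W 0, W 1, (Real.sqrt (2 * Real.sin (3 * t / 2) + nsq W) : ℂ)]) * J))))])) -
              iteratedFDeriv ℝ 2 Θ (((ζ * Circle.exp t : Circle) : ℂ) • (1 : Matrix (Fin 3) (Fin 3) ℂ) + (I * (ζ : ℂ) * Complex.exp (-(t / 2 : ℝ) * I)) • (vecMulVec ![W 0, W 1, (Real.sqrt (2 * Real.sin (3 * t / 2) + nsq W) : ℂ)] (star ![W 0, W 1, (Real.sqrt (2 * Real.sin (3 * t / 2) + nsq W) : ℂ)]) * J)) ![((ζ * Circle.exp t : Circle) : ℂ) • (I • (((Real.sqrt (2 * Real.sin (3 * t / 2) + nsq W) ^ 2 - nsq W : ℝ) : ℂ) • (1 : Matrix (Fin 3) (Fin 3) ℂ) + (vecMulVec ![W 0, W 1, (Real.sqrt (2 * Real.sin (3 *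 t / 2) + nsq W) : ℂ)] (star ![W 0, W 1, (Real.sqrt (2 * Real.sin (3 * t / 2) + nsq W) : ℂ)]) * J))), ((ζ * Circle.exp t : Circle) : ℂ) • (I • (((Real.sqrt (2 * Real.sin (3 * t / 2) + nsq W) ^ 2 - nsq W : ℝ) : ℂ) • (1 : Matrix (Fin 3) (Fin 3) ℂ) + (vecMulVec ![W 0, W 1, (Real.sqrt (2 * Real.sin (3 * t / 2) + nsq W) : ℂ)] (star ![W 0, W 1, (Real.sqrt (2 * Real.sin (3 * t / 2) + nsq W) : ℂ)]) * J)))]) -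
            (Real.sqrt (2 * Real.sin (3 * t / 2) + nsq W) ^ 2 - nsq W) • fderiv ℝ Θ (((ζ * Circle.exp t : Circle) : ℂ) • (1 : Matrix (Fin 3) (Fin 3) ℂ) + (I * (ζ : ℂ) * Complex.exp (-(t / 2 : ℝ) * I)) • (vecMulVec ![W 0, W 1, (Real.sqrt (2 * Real.sin (3 * t / 2) + nsq W) : ℂ)] (star ![W 0, W 1, (Real.sqrt (2 * Real.sin (3 * t / 2) + nsq W) : ℂ)]) * J)) (((ζ * Circle.exp t : Circle) : ℂ) • (((Real.sqrt (2 * Real.sin (3 * t / 2) + nsq W) ^ 2 - nsq W : ℝ) : ℂ) • (1 : Matrix (Fin 3) (Fin 3) ℂ) + (vecMulVec ![W 0, W 1, (Real.sqrt (2 * Real.sin (3 * t / 2) + nsq W) : ℂ)] (star ![W 0, W 1, (Real.sqrt (2 * Real.sin (3 * t / 2) + nsq W) : ℂ)]) * J))))) (Icc 0 δ) 0 =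
      ∫ W : Fin 2 → ℂ,
        ((fderiv ℝ (fderiv ℝ (fun p : ℝ × (Fin 2 → ℂ) × ℝ =>
          ((1 / 3 : ℝ) • ((∑ k, ∑ l, ((J k k * J l l).re • (iteratedFDeriv ℝ 2 Θ (((ζ * Circle.exp p.1 : Circle) : ℂ) • (1 : Matrix (Fin 3) (Fin 3) ℂ) + (I * (ζ : ℂ) * Complex.exp (-(p.1 / 2 : ℝ) * I)) • (vecMulVec ![p.2.1 0, p.2.1 1, (p.2.2 : ℂ)] (star ![p.2.1 0, p.2.1 1, (p.2.2 : ℂ)]) * J)) ![((ζ * Circle.exp p.1 : Circle) : ℂ) • (Matrix.single k l (1 : ℂ) * (((p.2.2 ^ 2 - nsq p.2.1 : ℝ) : ℂ) • (1 : Matrix (Fin 3) (Fin 3) ℂ) + (vecMulVec ![p.2.1 0, p.2.1 1, (p.2.2 : ℂ)] (star ![p.2.1 0, p.2.1 1, (p.2.2 : ℂ)]) * J))), ((ζ * Circle.exp p.1 : Circle) : ℂ) • ((((p.2.2 ^ 2 - nsq p.2.1 : ℝ) : ℂ) • (1 : Matrix (Fin 3) (Fin 3) ℂ) + (vecMulVec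 ![p.2.1 0, p.2.1 1, (p.2.2 : ℂ)] (star ![p.2.1 0, p.2.1 1, (p.2.2 : ℂ)]) * J)) * Matrix.single k l (1 : ℂ))] +
                  iteratedFDeriv ℝ 2 Θ (((ζ * Circle.exp p.1 : Circle) : ℂ) • (1 : Matrix (Fin 3) (Fin 3) ℂ) + (I * (ζ : ℂ) * Complex.exp (-(p.1 / 2 : ℝ) * I)) • (vecMulVec ![p.2.1 0, p.2.1 1, (p.2.2 : ℂ)] (star ![p.2.1 0, p.2.1 1, (p.2.2 : ℂ)]) * J)) ![((ζ * Circle.exp p.1 : Circle) : ℂ) • (I • (Matrix.single k l (1 : ℂ) * (((p.2.2 ^ 2 - nsq p.2.1 : ℝ) : ℂ) • (1 : Matrix (Fin 3) (Fin 3) ℂ) + (vecMulVec ![p.2.1 0, p.2.1 1, (p.2.2 : ℂ)] (star ![p.2.1 0, p.2.1 1, (p.2.2 : ℂ)]) * J)))), ((ζ * Circle.exp p.1 : Circle) : ℂ) • (I • ((((p.2.2 ^ 2 - nsq p.2.1 : ℝ) : ℂ) • (1 : Matrix (Fin 3) (Fin 3) ℂ) + (vecMulVec ![p.2.1 0, p.2.1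 1, (p.2.2 : ℂ)] (star ![p.2.1 0, p.2.1 1, (p.2.2 : ℂ)]) * J)) * Matrix.single k l (1 : ℂ)))]) -
                iteratedFDeriv ℝ 2 Θ (((ζ * Circle.exp p.1 : Circle) : ℂ) • (1 : Matrix (Fin 3) (Fin 3) ℂ) + (I * (ζ : ℂ) * Complex.exp (-(p.1 / 2 : ℝ) * I)) • (vecMulVec ![p.2.1 0, p.2.1 1, (p.2.2 : ℂ)] (star ![p.2.1 0, p.2.1 1, (p.2.2 : ℂ)]) * J)) ![((ζ * Circle.exp p.1 : Circle) : ℂ) • (Matrix.single k l (1 : ℂ) * (((p.2.2 ^ 2 - nsq p.2.1 : ℝ) : ℂ) • (1 : Matrix (Fin 3) (Fin 3) ℂ) + (vecMulVec ![p.2.1 0, p.2.1 1, (p.2.2 : ℂ)] (star ![p.2.1 0, p.2.1 1, (p.2.2 : ℂ)]) * J))), ((ζ * Circle.exp p.1 : Circle) : ℂ) • (Matrix.single l k (1 : ℂ) * (((p.2.2 ^ 2 - nsq p.2.1 : ℝ) : ℂ) • (1 : Matrix (Fin 3) (Fin 3) ℂ) + (vecMulVec ![p.2.1 0, p.2.1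 1, (p.2.2 : ℂ)] (star ![p.2.1 0, p.2.1 1, (p.2.2 : ℂ)]) * J)))] +
                iteratedFDeriv ℝ 2 Θ (((ζ * Circle.exp p.1 : Circle) : ℂ) • (1 : Matrix (Fin 3) (Fin 3) ℂ) + (I * (ζ : ℂ) * Complex.exp (-(p.1 / 2 : ℝ) * I)) • (vecMulVec ![p.2.1 0, p.2.1 1, (p.2.2 : ℂ)] (star ![p.2.1 0, p.2.1 1, (p.2.2 : ℂ)]) * J)) ![((ζ * Circle.exp p.1 : Circle) : ℂ) • (I • (Matrix.single k l (1 : ℂ) * (((p.2.2 ^ 2 - nsq p.2.1 : ℝ) : ℂ) • (1 : Matrix (Fin 3) (Fin 3) ℂ) + (vecMulVec ![p.2.1 0, p.2.1 1, (p.2.2 : ℂ)] (star ![p.2.1 0, p.2.1 1, (p.2.2 : ℂ)]) * J)))), ((ζ * Circle.exp p.1 : Circle) : ℂ) • (I • (Matrix.single l k (1 : ℂ) * (((p.2.2 ^ 2 - nsq p.2.1 : ℝ) : ℂ) • (1 : Matrix (Fin 3) (Fin 3) ℂ) + (vecMulVec ![p.2.1 0, p.2.1 1, (p.2.2 : ℂ)]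 (star ![p.2.1 0, p.2.1 1, (p.2.2 : ℂ)]) * J))))])) -
              iteratedFDeriv ℝ 2 Θ (((ζ * Circle.exp p.1 : Circle) : ℂ) • (1 : Matrix (Fin 3) (Fin 3) ℂ) + (I * (ζ : ℂ) * Complex.exp (-(p.1 / 2 : ℝ) * I)) • (vecMulVec ![p.2.1 0, p.2.1 1, (p.2.2 : ℂ)] (star ![p.2.1 0, p.2.1 1, (p.2.2 : ℂ)]) * J)) ![((ζ * Circle.exp p.1 : Circle) : ℂ) • (I • (((p.2.2 ^ 2 - nsq p.2.1 : ℝ) : ℂ) • (1 : Matrix (Fin 3) (Fin 3) ℂ) + (vecMulVec ![p.2.1 0, p.2.1 1, (p.2.2 : ℂ)] (star ![p.2.1 0, p.2.1 1, (p.2.2 : ℂ)]) * J))), ((ζ * Circle.exp p.1 : Circle) : ℂ) • (I • (((p.2.2 ^ 2 - nsq p.2.1 : ℝ) : ℂ) • (1 : Matrix (Fin 3) (Fin 3) ℂ) + (vecMulVec ![p.2.1 0, p.2.1 1, (p.2.2 : ℂ)] (star ![p.2.1 0, p.2.1 1, (p.2.2 : ℂ)]) * J)))]) -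
            (p.2.2 ^ 2 - nsq p.2.1) • fderiv ℝ Θ (((ζ * Circle.exp p.1 : Circle) : ℂ) • (1 : Matrix (Fin 3) (Fin 3) ℂ) + (I * (ζ : ℂ) * Complex.exp (-(p.1 / 2 : ℝ) * I)) • (vecMulVec ![p.2.1 0, p.2.1 1, (p.2.2 : ℂ)] (star ![p.2.1 0, p.2.1 1, (p.2.2 : ℂ)]) * J)) (((ζ * Circle.exp p.1 : Circle) : ℂ) • (((p.2.2 ^ 2 - nsq p.2.1 : ℝ) : ℂ) • (1 : Matrix (Fin 3) (Fin 3) ℂ) + (vecMulVec ![p.2.1 0, p.2.1 1, (p.2.2 : ℂ)] (star ![p.2.1 0, p.2.1 1, (p.2.2 : ℂ)]) * J))))))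
            (0, W, Real.sqrt (2 * Real.sin (3 * (0 : ℝ) / 2) + nsq W))
            ((1 : ℝ), (0 : Fin 2 → ℂ), 3 * Real.cos (3 * (0 : ℝ) / 2) * (2 * Real.sqrt (2 * Real.sin (3 * (0 : ℝ) / 2) + nsq W))⁻¹))
            ((1 : ℝ), (0 : Fin 2 → ℂ), 3 * Real.cos (3 * (0 : ℝ) / 2) * (2 * Real.sqrt (2 * Real.sin (3 * (0 : ℝ) / 2) + nsq W))⁻¹) +
          (fderiv ℝ (fun p : ℝ × (Fin 2 → ℂ) × ℝ =>
          ((1 / 3 : ℝ) • ((∑ k, ∑ l, ((J k k * J l l).re • (iteratedFDeriv ℝ 2 Θ (((ζ * Circle.exp p.1 : Circle) : ℂ) • (1 : Matrix (Fin 3) (Fin 3) ℂ) + (I * (ζ : ℂ) * Complex.exp (-(p.1 / 2 : ℝ) * I)) • (vecMulVec ![p.2.1 0, p.2.1 1, (p.2.2 : ℂ)] (star ![p.2.1 0, p.2.1 1, (p.2.2 : ℂ)]) * J)) ![((ζ * Circle.exp p.1 : Circle) : ℂ) • (Matrix.single k l (1 : ℂ) * (((p.2.2 ^ 2 - nsq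 p.2.1 : ℝ) : ℂ) • (1 : Matrix (Fin 3) (Fin 3) ℂ) + (vecMulVec ![p.2.1 0, p.2.1 1, (p.2.2 : ℂ)] (star ![p.2.1 0, p.2.1 1, (p.2.2 : ℂ)]) * J))), ((ζ * Circle.exp p.1 : Circle) : ℂ) • ((((p.2.2 ^ 2 - nsq p.2.1 : ℝ) : ℂ) • (1 : Matrix (Fin 3) (Fin 3) ℂ) + (vecMulVec ![p.2.1 0, p.2.1 1, (p.2.2 : ℂ)] (star ![p.2.1 0, p.2.1 1, (p.2.2 : ℂ)]) * J)) * Matrix.single k l (1 : ℂ))] +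
                  iteratedFDeriv ℝ 2 Θ (((ζ * Circle.exp p.1 : Circle) : ℂ) • (1 : Matrix (Fin 3) (Fin 3) ℂ) + (I * (ζ : ℂ) * Complex.exp (-(p.1 / 2 : ℝ) * I)) • (vecMulVec ![p.2.1 0, p.2.1 1, (p.2.2 : ℂ)] (star ![p.2.1 0, p.2.1 1, (p.2.2 : ℂ)]) * J)) ![((ζ * Circle.exp p.1 : Circle) : ℂ) • (I • (Matrix.single k l (1 : ℂ) * (((p.2.2 ^ 2 - nsq p.2.1 : ℝ) : ℂ) • (1 : Matrix (Fin 3) (Fin 3) ℂ) + (vecMulVec ![p.2.1 0, p.2.1 1, (p.2.2 : ℂ)] (star ![p.2.1 0, p.2.1 1, (p.2.2 : ℂ)]) * J)))), ((ζ * Circle.exp p.1 : Circle) : ℂ) • (I • ((((p.2.2 ^ 2 - nsq p.2.1 : ℝ) : ℂ) • (1 : Matrix (Fin 3) (Fin 3) ℂ) + (vecMulVec ![p.2.1 0, p.2.1 1, (p.2.2 : ℂ)] (star ![p.2.1 0, p.2.1 1, (p.2.2 : ℂ)]) * J)) * Matrix.single k l (1 : ℂ)))]) -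
                iteratedFDeriv ℝ 2 Θ (((ζ * Circle.exp p.1 : Circle) : ℂ) • (1 : Matrix (Fin 3) (Fin 3) ℂ) + (I * (ζ : ℂ) * Complex.exp (-(p.1 / 2 : ℝ) * I)) • (vecMulVec ![p.2.1 0, p.2.1 1, (p.2.2 : ℂ)] (star ![p.2.1 0, p.2.1 1, (p.2.2 : ℂ)]) * J)) ![((ζ * Circle.exp p.1 : Circle) : ℂ) • (Matrix.single k l (1 : ℂ) * (((p.2.2 ^ 2 - nsq p.2.1 : ℝ) : ℂ) • (1 : Matrix (Fin 3) (Fin 3) ℂ) + (vecMulVec ![p.2.1 0, p.2.1 1, (p.2.2 : ℂ)] (star ![p.2.1 0, p.2.1 1, (p.2.2 : ℂ)]) * J))), ((ζ * Circle.exp p.1 : Circle) : ℂ) • (Matrix.single l k (1 : ℂ) * (((p.2.2 ^ 2 - nsq p.2.1 : ℝ) : ℂ) • (1 : Matrix (Fin 3) (Fin 3) ℂ) + (vecMulVec ![p.2.1 0, p.2.1 1, (p.2.2 : ℂ)] (star ![p.2.1 0, p.2.1 1, (p.2.2 : ℂ)]) * J)))] +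
                iteratedFDeriv ℝ 2 Θ (((ζ * Circle.exp p.1 : Circle) : ℂ) • (1 : Matrix (Fin 3) (Fin 3) ℂ) + (I * (ζ : ℂ) * Complex.exp (-(p.1 / 2 : ℝ) * I)) • (vecMulVec ![p.2.1 0, p.2.1 1, (p.2.2 : ℂ)] (star ![p.2.1 0, p.2.1 1, (p.2.2 : ℂ)]) * J)) ![((ζ * Circle.exp p.1 : Circle) : ℂ) • (I • (Matrix.single k l (1 : ℂ) * (((p.2.2 ^ 2 - nsq p.2.1 : ℝ) : ℂ) • (1 : Matrix (Fin 3) (Fin 3) ℂ) + (vecMulVec ![p.2.1 0, p.2.1 1, (p.2.2 : ℂ)] (star ![p.2.1 0, p.2.1 1, (p.2.2 : ℂ)]) * J)))), ((ζ * Circle.exp p.1 : Circle) : ℂ) • (I • (Matrix.single l k (1 : ℂ) * (((p.2.2 ^ 2 - nsq p.2.1 : ℝ) : ℂ) • (1 : Matrix (Fin 3) (Fin 3) ℂ) + (vecMulVec ![p.2.1 0, p.2.1 1, (p.2.2 : ℂ)] (star ![p.2.1 0, p.2.1 1, (p.2.2 : ℂ)]) * J))))])) -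
              iteratedFDeriv ℝ 2 Θ (((ζ * Circle.exp p.1 : Circle) : ℂ) • (1 : Matrix (Fin 3) (Fin 3) ℂ) + (I * (ζ : ℂ) * Complex.exp (-(p.1 / 2 : ℝ) * I)) • (vecMulVec ![p.2.1 0, p.2.1 1, (p.2.2 : ℂ)] (star ![p.2.1 0, p.2.1 1, (p.2.2 : ℂ)]) * J)) ![((ζ * Circle.exp p.1 : Circle) : ℂ) • (I • (((p.2.2 ^ 2 - nsq p.2.1 : ℝ) : ℂ) • (1 : Matrix (Fin 3) (Fin 3) ℂ) + (vecMulVec ![p.2.1 0, p.2.1 1, (p.2.2 : ℂ)] (star ![p.2.1 0, p.2.1 1, (p.2.2 : ℂ)]) * J))), ((ζ * Circle.exp p.1 : Circle) : ℂ) • (I • (((p.2.2 ^ 2 - nsq p.2.1 : ℝ) : ℂ) • (1 : Matrix (Fin 3) (Fin 3) ℂ) + (vecMulVec ![p.2.1 0, p.2.1 1, (p.2.2 : ℂ)] (star ![p.2.1 0, p.2.1 1, (p.2.2 : ℂ)]) * J)))]) -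
            (p.2.2 ^ 2 - nsq p.2.1) • fderiv ℝ Θ (((ζ * Circle.exp p.1 : Circle) : ℂ) • (1 : Matrix (Fin 3) (Fin 3) ℂ) + (I * (ζ : ℂ) * Complex.exp (-(p.1 / 2 : ℝ) * I)) • (vecMulVec ![p.2.1 0, p.2.1 1, (p.2.2 : ℂ)] (star ![p.2.1 0, p.2.1 1, (p.2.2 : ℂ)]) * J)) (((ζ * Circle.exp p.1 : Circle) : ℂ) • (((p.2.2 ^ 2 - nsq p.2.1 : ℝ) : ℂ) • (1 : Matrix (Fin 3) (Fin 3) ℂ) + (vecMulVec ![p.2.1 0, p.2.1 1, (p.2.2 : ℂ)] (star ![p.2.1 0, p.2.1 1, (p.2.2 : ℂ)]) * J)))))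
            (0, W, Real.sqrt (2 * Real.sin (3 * (0 : ℝ) / 2) + nsq W)))
            ((0 : ℝ), (0 : Fin 2 → ℂ), -(9 / 2) * Real.sin (3 * (0 : ℝ) / 2) * (2 * Real.sqrt (2 * Real.sin (3 * (0 : ℝ) / 2) + nsq W))⁻¹ -
              (3 * Real.cos (3 * (0 : ℝ) / 2)) ^ 2 * (4 * Real.sqrt (2 * Real.sin (3 * (0 : ℝ) / 2) + nsq W) ^ 3)⁻¹)) := by
  obtain ⟨S, hS⟩ := exists_sq_support_bound_transversalDatum Θ hΘc ζ
  have hε₂c : Continuous fun t : ℝ => -(9 / 2) * Real.sin (3 * t / 2) := by fun_prop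
  exact iteratedDerivWithin_two_integral_family_zero (T := 2 * Real.pi / 3)
    (Λ := (fun p : ℝ × (Fin 2 → ℂ) × ℝ =>
          ((1 / 3 : ℝ) • ((∑ k, ∑ l, ((J k k * J l l).re • (iteratedFDeriv ℝ 2 Θ (((ζ * Circle.exp p.1 : Circle) : ℂ) • (1 : Matrix (Fin 3) (Fin 3) ℂ) + (I * (ζ : ℂ) * Complex.exp (-(p.1 / 2 : ℝ) * I)) • (vecMulVec ![p.2.1 0, p.2.1 1, (p.2.2 : ℂ)] (star ![p.2.1 0, p.2.1 1, (p.2.2 : ℂ)]) * J)) ![((ζ * Circle.exp p.1 : Circle) : ℂ) • (Matrix.single k l (1 : ℂ) * (((p.2.2 ^ 2 - nsq p.2.1 : ℝ) : ℂ) • (1 : Matrix (Fin 3) (Fin 3) ℂ) + (vecMulVec ![p.2.1 0, p.2.1 1, (p.2.2 : ℂ)] (star ![p.2.1 0, p.2.1 1, (p.2.2 : ℂ)]) * J))), ((ζ * Circle.exp p.1 : Circle) : ℂ) • ((((p.2.2 ^ 2 - nsq p.2.1 : ℝ) : ℂ) • (1 : Matrix (Fin 3) (Fin 3) ℂ) +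 (vecMulVec ![p.2.1 0, p.2.1 1, (p.2.2 : ℂ)] (star ![p.2.1 0, p.2.1 1, (p.2.2 : ℂ)]) * J)) * Matrix.single k l (1 : ℂ))] +
                  iteratedFDeriv ℝ 2 Θ (((ζ * Circle.exp p.1 : Circle) : ℂ) • (1 : Matrix (Fin 3) (Fin 3) ℂ) + (I * (ζ : ℂ) * Complex.exp (-(p.1 / 2 : ℝ) * I)) • (vecMulVec ![p.2.1 0, p.2.1 1, (p.2.2 : ℂ)] (star ![p.2.1 0, p.2.1 1, (p.2.2 : ℂ)]) * J)) ![((ζ * Circle.exp p.1 : Circle) : ℂ) • (I • (Matrix.single k l (1 : ℂ) * (((p.2.2 ^ 2 - nsq p.2.1 : ℝ) : ℂ) • (1 : Matrix (Fin 3) (Fin 3) ℂ) + (vecMulVec ![p.2.1 0, p.2.1 1, (p.2.2 : ℂ)] (star ![p.2.1 0, p.2.1 1, (p.2.2 : ℂ)]) * J)))), ((ζ * Circle.exp p.1 : Circle) : ℂ) • (I • ((((p.2.2 ^ 2 - nsq p.2.1 : ℝ) : ℂ) • (1 : Matrix (Fin 3) (Fin 3) ℂ) + (vecMulVec ![p.2.1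 0, p.2.1 1, (p.2.2 : ℂ)] (star ![p.2.1 0, p.2.1 1, (p.2.2 : ℂ)]) * J)) * Matrix.single k l (1 : ℂ)))]) -
                iteratedFDeriv ℝ 2 Θ (((ζ * Circle.exp p.1 : Circle) : ℂ) • (1 : Matrix (Fin 3) (Fin 3) ℂ) + (I * (ζ : ℂ) * Complex.exp (-(p.1 / 2 : ℝ) * I)) • (vecMulVec ![p.2.1 0, p.2.1 1, (p.2.2 : ℂ)] (star ![p.2.1 0, p.2.1 1, (p.2.2 : ℂ)]) * J)) ![((ζ * Circle.exp p.1 : Circle) : ℂ) • (Matrix.single k l (1 : ℂ) * (((p.2.2 ^ 2 - nsq p.2.1 : ℝ) : ℂ) • (1 : Matrix (Fin 3) (Fin 3) ℂ) + (vecMulVec ![p.2.1 0, p.2.1 1, (p.2.2 : ℂ)] (star ![p.2.1 0, p.2.1 1, (p.2.2 : ℂ)]) * J))), ((ζ * Circle.exp p.1 : Circle) : ℂ) • (Matrix.single l k (1 : ℂ) * (((p.2.2 ^ 2 - nsq p.2.1 : ℝ) : ℂ) • (1 : Matrix (Fin 3) (Fin 3) ℂ) + (vecMulVec ![p.2.1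 0, p.2.1 1, (p.2.2 : ℂ)] (star ![p.2.1 0, p.2.1 1, (p.2.2 : ℂ)]) * J)))] +
                iteratedFDeriv ℝ 2 Θ (((ζ * Circle.exp p.1 : Circle) : ℂ) • (1 : Matrix (Fin 3) (Fin 3) ℂ) + (I * (ζ : ℂ) * Complex.exp (-(p.1 / 2 : ℝ) * I)) • (vecMulVec ![p.2.1 0, p.2.1 1, (p.2.2 : ℂ)] (star ![p.2.1 0, p.2.1 1, (p.2.2 : ℂ)]) * J)) ![((ζ * Circle.exp p.1 : Circle) : ℂ) • (I • (Matrix.single k l (1 : ℂ) * (((p.2.2 ^ 2 - nsq p.2.1 : ℝ) : ℂ) • (1 : Matrix (Fin 3) (Fin 3) ℂ) + (vecMulVec ![p.2.1 0, p.2.1 1, (p.2.2 : ℂ)] (star ![p.2.1 0, p.2.1 1, (p.2.2 : ℂ)]) * J)))), ((ζ * Circle.exp p.1 : Circle) : ℂ) • (I • (Matrix.single l k (1 : ℂ) * (((p.2.2 ^ 2 - nsq p.2.1 : ℝ) : ℂ) • (1 : Matrix (Fin 3) (Fin 3) ℂ) + (vecMulVec ![p.2.1 0, p.2.1 1, (p.2.2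 : ℂ)] (star ![p.2.1 0, p.2.1 1, (p.2.2 : ℂ)]) * J))))])) -
              iteratedFDeriv ℝ 2 Θ (((ζ * Circle.exp p.1 : Circle) : ℂ) • (1 : Matrix (Fin 3) (Fin 3) ℂ) + (I * (ζ : ℂ) * Complex.exp (-(p.1 / 2 : ℝ) * I)) • (vecMulVec ![p.2.1 0, p.2.1 1, (p.2.2 : ℂ)] (star ![p.2.1 0, p.2.1 1, (p.2.2 : ℂ)]) * J)) ![((ζ * Circle.exp p.1 : Circle) : ℂ) • (I • (((p.2.2 ^ 2 - nsq p.2.1 : ℝ) : ℂ) • (1 : Matrix (Fin 3) (Fin 3) ℂ) + (vecMulVec ![p.2.1 0, p.2.1 1, (p.2.2 : ℂ)] (star ![p.2.1 0, p.2.1 1, (p.2.2 : ℂ)]) * J))), ((ζ * Circle.exp p.1 : Circle) : ℂ) • (I • (((p.2.2 ^ 2 - nsq p.2.1 : ℝ) : ℂ) • (1 : Matrix (Fin 3) (Fin 3) ℂ) + (vecMulVec ![p.2.1 0, p.2.1 1, (p.2.2 : ℂ)] (star ![p.2.1 0, p.2.1 1, (p.2.2 : ℂ)]) * J)))]) -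
            (p.2.2 ^ 2 - nsq p.2.1) • fderiv ℝ Θ (((ζ * Circle.exp p.1 : Circle) : ℂ) • (1 : Matrix (Fin 3) (Fin 3) ℂ) + (I * (ζ : ℂ) * Complex.exp (-(p.1 / 2 : ℝ) * I)) • (vecMulVec ![p.2.1 0, p.2.1 1, (p.2.2 : ℂ)] (star ![p.2.1 0, p.2.1 1, (p.2.2 : ℂ)]) * J)) (((ζ * Circle.exp p.1 : Circle) : ℂ) • (((p.2.2 ^ 2 - nsq p.2.1 : ℝ) : ℂ) • (1 : Matrix (Fin 3) (Fin 3) ℂ) + (vecMulVec ![p.2.1 0, p.2.1 1, (p.2.2 : ℂ)] (star ![p.2.1 0, p.2.1 1, (p.2.2 : ℂ)]) * J))))))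
    (ε := fun t : ℝ => 2 * Real.sin (3 * t / 2)) (ε₁ := fun t : ℝ => 3 * Real.cos (3 * t / 2)) (ε₂ := fun t : ℝ => -(9 / 2) * Real.sin (3 * t / 2))
    (contDiff_two_transversalDatum Θ hΘ ζ) hS hasDerivAt_wallRadius hasDerivAt_wallRadius_deriv hε₂c (fun t ht => wallRadius_nonneg ht) (fun t ht => wallRadius_pos ht) hδ hδ'

end Jets

end Literature.Geometry.ComplexHyperbolic.BallModel

end
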